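import Summits.BirchSwinnertonDyer.BirchSwinnertonDyer.Theorems.ErratumRoadFiveNonSurjCornerMuTransferMult
import Summits.BirchSwinnertonDyer.BirchSwinnertonDyer.Theorems.PrintX11aNonSurjMuAnHardDefs
import Literature.NumberTheory.EllipticCurves.KatoFineSelmerFiniteProofs
import Literature.NumberTheory.EllipticCurves.IwasawaModuleFinitePadicIntProofs
import Literature.NumberTheory.EllipticCurves.KatoRankBoundProofs
import Literature.NumberTheory.EllipticCurves.IwasawaOrderOfVanishingProofs
import Literature.NumberTheory.EllipticCurves.PAdicBSDSplitMultiplicativeProofs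
import Literature.NumberTheory.EllipticCurves.PAdicLFunctionNonsplitMultiplicativeExistenceProofs
import Literature.NumberTheory.EllipticCurves.SkinnerUrban2014.PAdicUnitPeriodRatioProofs
import Literature.NumberTheory.EllipticCurves.Rank1Residual.MuLambdaCarriers
import Literature.NumberTheory.EllipticCurves.TateModuleContinuityProofs
import Literature.NumberTheory.EllipticCurves.TateModuleFreeProofs
import HarnessLib

/-!
# Route `PrintX11a`, child crux U3 = `PrintX11a.UpperNonSurjThree` (item stmt-BirchSwinnertonDyer-20613), line
# «finemu3»: the μ-ROAD IMPLIES THE (A)-ROAD — one `p`-adic unit coefficient of the Néron-normalised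
# Mazur–Tate–Teitelbaum function at an odd MULTIPLICATIVE prime with `E[p]` irreducible and `ρ̄` not onto gives
# Coates–Sujatha's statement (A) at the pair; hence the registered stub `stub_conjA_hardThree` follows from the
# registered stub `stub_muAnHardThree` modulo four facts of K2's bundle 19949
# (cell `bsd-print-x11a`, LEAD seat `bsd-line-x11a-p1` g0, D-0154 row 11; `--supports stmt-BirchSwinnertonDyer-20613`)

HONEST FRAMING.  BSD is not proved by any of this; nothing is asserted about any curve; item 20613 does NOT
close (its open registered inputs stay `stub_conjA_three` ⊇ `stub_conjA_hardThree`, `stub_muAnHardThree`,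
`stub_pubFactsAn` = item 19949).  THEOREMS ONLY (no definition, no named fact minted, no `sorry`, no instance,
no notation), every one CONDITIONAL on its displayed hypotheses: the Kato CONSTRUCTION fact
`Kato2004.exists_multDivisibilityInputs_fine` (flags `Kato-17.11-at-{nonsplit,split}-mult`, `Kato-p280-image-at-mult`,
rider R-48 ride on IT), Wuthrich 2014 Cor. 18, and in §3 modularity (`exists_isNewformOf`) and Mazur's Manin-constant
fact (`mazur_not_dvd_maninConstant_of_odd`) — all four are conjuncts of `Theses.ErratumRoadFive.KatoTwinFactsFiveAn`.
PARTITION 0.  Beyond-print theorem: no (Kato 2004 §13.8/§17.13 mechanism; Coates–Sujatha 2005 Lemma 3.1).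

WHAT.  The multiplicative twin of cell `bsd-f3-mu`'s good-ordinary theorem
`OneSidedTwistSqueezeX9KatoDivisibilityX9OfAnalyticMuZeroX9FineAlone.conjAAt_of_cert_of_fine` (F1_ζ ⟹ μ^an-certificate
⟹ (A)), obtained by EXPOSING the intermediate of the corner seat's μ-transfer `X11b.MultMu.mu_eq_zero_of_multFine`
(Theorems/ErratumRoadFiveNonSurjCornerMuTransferMult.lean, p ∥ N): certificate ⟹ `G₁ ∉ (p)` (`ι G₁ = ϖ·L`, Cor. 18)
⟹ (Thm. 12.6 span + p. 280 image clause of the fine package) a GENUINE `Λ`-adic Euler-system class `∉ p𝐇¹`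
⟹ (`CoreAssembly.coreOdd_anyReduction_holds`, every odd prime, no reduction hypothesis) a power of `T` kills the
`E[p]`-lifts of `Sel₀(ℚ_∞, E[p^∞])` ⟹ `Sel₀(ℚ_∞, E[p^∞])[p]` FINITE (`finite_fineSelmerInfty_pTorsion_of_forall_iterate_eq_zero`).
There the μ-transfer continues to `ℓ_(p) X₀ = 0 ⟹ ℓ_(p) X = 0`; here we stop and read the finiteness as
statement (A) through the tree's `IwasawaModuleFinitePadicInt.exists_fineSelmerDualData_moduleFinite_iff_finite_pTorsion`
(«`Y(E/F_∞)` f.g. over `ℤ_p` ⟺ `R(E/F_∞)[p]` finite», Coates–Sujatha Lemma 3.1 / Lim–Sujatha §3), after transporting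
the finiteness from the normalised cyclotomic datum to every cyclotomic `κ` (same `ker κ`).

* §1 `finite_fineSelmerInfty_pTorsion_of_muCert_of_multFine` (per cyclotomic datum with cyclotomic variable) and
  `…_of_muCert_of_multFine'` (every cyclotomic `κ`; the transport along `ker κ₀ = ker κ` is the `subst` device of the
  f3-mu cell's `finite_fineSelmerInfty_pTorsion_of_isCyclotomic`, inlined so that this module stays route-free).
* §2 `conjAAt_of_muCert_of_multFine` — **(A) at the pair** from ONE newform `f`, ONE `ϖ` (`ϖ·Ω_W = Ω⁺_f`), ONE MTT
  function `L` (`a = ±1` by the split type) with ONE unit coefficient of `ϖ·L`; `fineMuZeroAt_of_muCert_of_multFine`.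
* §3 THE LINE EDGE on the U3 domain: `conjAHardThree_of_muAnHardThree` — `Theorems.X11aNonSurjMuAnHardThree`
  (registered stub `stub_muAnHardThree`, the μ-road's open input) and the four facts give the statement of the
  registered stub `stub_conjA_hardThree` VERBATIM (newform: modularity; `ϖ`: Mazur 1978 Cor. 4.1 at `p ∥ N`, where
  `p² ∤ N`; `L`: the tree's MTT existence theorems `exists_isSplitMultPAdicLFunctionOf` /
  `exists_isMultPAdicLFunctionOf_neg_one_of_nonsplit`); and `conjAThree_of_muAnAtThree_onDomain` (whole U3 domain from
  a whole-domain μ^an certificate).  So on line «finemu3» the (A)-road's hard-locus stub is the WEAKEST registered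
  open input (⟸ `stub_conjA_three` trivially; ⟸ `stub_muAnHardThree` mod 19949), and per pair every landed
  hard-locus μ-record (p3's `MuCosetRecords` @3) is ALSO an (A)-certificate — a second instrument, independent of the
  class-group screen of the (A)-road (Deo–Ray–Sujatha doors), at the same pairs.

References: [Kato2004Asterisque] Thm. 12.4–12.6 (pp. 221–222), Ex. 13.3 (p. 225), §13.8 (p. 228), (14.9.3) (p. 240),
§17.13 (pp. 279–280); [CoatesSujatha2005] §3 statement (A), Lemma 3.1, Thm. 3.4; [LimSujatha2018] §3;
[Wuthrich2014] p. 391, Cor. 18 (p. 398); [Kobayashi2006DocMath] Thm. 4.1; [GreenbergLNM1716] §1 p. 60, Conj. 1.11;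
[Mazur1978] Cor. 4.1; [MazurTateTeitelbaum1986Invent] §I.10, §I.14; tree: `Theorems/ErratumRoadFiveNonSurjCorner{MuCore,MuTransferMult}.lean`
(bsd-stepL corner-p1 g6), `Theorems/OneSidedTwistSqueezeX9KatoDivisibilityX9OfAnalyticMuZeroX9FineAlone.lean` (bsd-f3-mu p1 g4),
`KatoFineSelmerFiniteProofs.lean`, `IwasawaModuleFinitePadicIntProofs.lean`, line card `Cruxes/UpperNonSurjThree/Lines/finemu3.md`.
-/

set_option autoImplicit false
set_option linter.dupNamespace false

noncomputable section

open scoped Classical MatrixGroups ModularForm NumberField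
open CongruenceSubgroup WeierstrassCurve Field IsDedekindDomain
open Literature.NumberTheory.GaloisRepresentations
open Literature.NumberTheory.GaloisCohomology
open Literature.NumberTheory.EllipticCurves Literature.NumberTheory.EllipticCurves.ModularForms
open Literature.NumberTheory.EllipticCurves.Kato2004 Literature.NumberTheory.EllipticCurves.Kato2004.EulerSystemValues
open Literature.NumberTheory.EllipticCurves.Rank1Residual
open Literature.NumberTheory.EllipticCurves.IwasawaModuleFinitePadicInt
open Literature.NumberTheory.EllipticCurves.SkinnerUrban2014
open Summit.BirchSwinnertonDyer.BirchSwinnertonDyer.Rank1Residual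
open Summit.BirchSwinnertonDyer.Rank1Residual
open Summit.BirchSwinnertonDyer.Rank1Residual.X11b.MultMu

namespace Summit.BirchSwinnertonDyer.BirchSwinnertonDyer.Theorems.UpperNonSurjThreeConjAOfMuAn

/-! ### §1 `Sel₀(ℚ_∞, E[p^∞])[p]` is finite from ONE unit coefficient, at a multiplicative odd prime -/

section PerPair

variable {p : ℕ} [Fact p.Prime] {W : WeierstrassCurve ℚ} [W.IsElliptic] [W.IsGloballyMinimal]

/-- **`Sel₀(ℚ_∞, E[p^∞])[p]` is finite** at an ODD prime `p` of MULTIPLICATIVE reduction with `E[p]` irreducible and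
`ρ̄_{E,p}` not surjective, over a cyclotomic datum `(κ, γ)` matching the cyclotomic variable, as soon as for ONE
newform `f` of `E`, ONE `ϖ` with `ϖ·Ω_W = Ω⁺_f` and ONE Mazur–Tate–Teitelbaum function `L` (`a = ±1` by the split
type) some coefficient of `ϖ·L` is a `p`-adic unit — modulo `Kato2004.exists_multDivisibilityInputs_fine` and
Wuthrich Cor. 18.  The first half of `X11b.MultMu.mu_eq_zero_of_multFine`'s proof, verbatim, stopped at the
finiteness (`finite_fineSelmerInfty_pTorsion_of_forall_iterate_eq_zero`).
[cite: Kato2004Asterisque, Thm. 12.6 (p. 222), §13.8 (p. 228), (14.9.3) (p. 240), §17.13 (pp. 279–280)]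
[cite: Wuthrich2014, p. 391 and Cor. 18 (p. 398)] -/
theorem finite_fineSelmerInfty_pTorsion_of_muCert_of_multFine (hfine : exists_multDivisibilityInputs_fine)
    (h18 : Wuthrich2014.corollary18_padicLFunction_mem_iwasawaAlgebra_multiplicative)
    (hp2 : p ≠ 2) (hmult : W.HasMultiplicativeReductionAtPrime p)
    (hirr : W.HasIrreducibleModPGaloisRep p) (hnsurj : ¬ W.HasSurjectiveModNGaloisRep p)
    {N : ℕ} [NeZero N] {f : CuspForm (Gamma0 N) 2} (hf : IsNewformOf W f)
    {ϖ : ℚ} (hϖ : (ϖ : ℝ) * W.realPeriodRat = plusPeriod f)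
    {a : ℚ_[p]} {L : PowerSeries ℚ_[p]}
    (hsa : W.HasSplitMultiplicativeReductionAtPrime p → a = 1)
    (hna : ¬ W.HasSplitMultiplicativeReductionAtPrime p → a = -1)
    (hL : IsMultPAdicLFunctionOf f p a L)
    (hcert : ∃ n : ℕ, ‖PowerSeries.coeff n (PowerSeries.C ((ϖ : ℚ) : ℚ_[p]) * L)‖ = 1)
    (κ : ZpExtension ℚ p) {γ : absoluteGaloisGroup ℚ} (hκ : κ.IsCyclotomic) (hγ : κ.IsTopGenerator γ)
    (hγ' : IsCyclotomicVariable p γ) :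
    Set.Finite {s : W.fineSelmerInfty κ | p • s = 0} := by
  haveI : ContinuousSMul ℤ_[p] (W.tateModule p) := TateModule.continuousSMul_padicInt
  haveI : Module.Free ℤ_[p] (W.tateModule p) := W.module_free_tateModule_holds p
  haveI : Module.Finite ℤ_[p] (W.tateModule p) := W.module_finite_tateModule_holds p
  -- the pinned modules: `𝐇¹_Γ(T_pW)`, the canonical dual Selmer datum and a dual fine Selmer datum over `(κ, γ)`
  obtain ⟨I⟩ := nonempty_iwasawaH1Data_holds W p κ γ hκ hγ
  let D : W.SelmerDualData κ γ := W.selmerDualData κ hγ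
  obtain ⟨Y⟩ := W.nonempty_fineSelmerDualData κ hγ
  -- Kato's package at the multiplicative prime, with the span and the image clauses
  obtain ⟨K, π, -, -, -, hZ, himg⟩ := hfine W p f κ γ hp2 hmult hκ hγ hγ' hf a L hsa hna hL I D Y
  -- `ϖ·L ∈ Λ` (Wuthrich 2014 Cor. 18) and the certificate: `G₁ ∉ (p)`
  obtain ⟨G₁, hG₁⟩ : ∃ G₁ : IwasawaAlgebra p,
      iwasawaToPowerSeries p G₁ = PowerSeries.C ((ϖ : ℚ) : ℚ_[p]) * L := by
    obtain ⟨hns, hs⟩ := h18 W p hp2 hmult hf ϖ hϖ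
    by_cases hsplit : W.HasSplitMultiplicativeReductionAtPrime p
    · have ha : a = 1 := hsa hsplit
      subst ha
      exact hs hsplit L ((isMultPAdicLFunctionOf_one_iff L).mp hL)
    · have ha : a = -1 := hna hsplit
      subst ha
      exact hns hsplit L hL
  have hμL : G₁ ∉ IwasawaAlgebra.augIdealP p := not_mem_augIdealP_of_norm_coeff_eq_one hG₁ hcert
  let 𝔭 : PrimeSpectrum (IwasawaAlgebra p) :=
    ⟨IwasawaAlgebra.augIdealP p, IwasawaAlgebra.isPrime_augIdealP_holds p⟩
  have himg𝔭 : ∃ s : IwasawaAlgebra p, s ∉ IwasawaAlgebra.augIdealP p ∧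
      s * G₁ ∈ Submodule.map (K.col ∘ₗ K.loc) K.Z := by
    obtain ⟨s, hs, hsG, -⟩ :=
      himg hirr G₁ ϖ hϖ hG₁ 𝔭 (by exact IwasawaAlgebra.height_augIdealP_holds p)
    exact ⟨s, hs, hsG⟩
  -- §6 (i): some GENUINE Euler-system class is not divisible by `p`
  obtain ⟨s, hs, hsp⟩ := exists_isEulerSystemClass_not_mem_of_mult K hZ hμL himg𝔭
  -- the reduction-free core: a power of `T` kills the `E[p]`-lifts of `Sel₀`
  obtain ⟨J, hJ⟩ := CoreAssembly.coreOdd_anyReduction_holds W p κ γ I hp2 hirr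
    (by exact_mod_cast hnsurj) hκ hγ ⟨s, hs, hsp⟩
  exact W.finite_fineSelmerInfty_pTorsion_of_forall_iterate_eq_zero κ hγ hJ

/-- **`Sel₀(ℚ_∞, E[p^∞])[p]` finite for EVERY cyclotomic `κ`** under the hypotheses of
`finite_fineSelmerInfty_pTorsion_of_muCert_of_multFine` (run at the normalised cyclotomic datum of
`exists_isCyclotomic_isTopGenerator_isCyclotomicVariable_holds`, then transported).
[cite: Kato2004Asterisque, Thm. 12.6 (p. 222) and §17.13 (pp. 279–280)] [cite: Wuthrich2014, Cor. 18 (p. 398)] -/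
theorem finite_fineSelmerInfty_pTorsion_of_muCert_of_multFine' (hfine : exists_multDivisibilityInputs_fine)
    (h18 : Wuthrich2014.corollary18_padicLFunction_mem_iwasawaAlgebra_multiplicative)
    (hp2 : p ≠ 2) (hmult : W.HasMultiplicativeReductionAtPrime p)
    (hirr : W.HasIrreducibleModPGaloisRep p) (hnsurj : ¬ W.HasSurjectiveModNGaloisRep p)
    {N : ℕ} [NeZero N] {f : CuspForm (Gamma0 N) 2} (hf : IsNewformOf W f)
    {ϖ : ℚ} (hϖ : (ϖ : ℝ) * W.realPeriodRat = plusPeriod f)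
    {a : ℚ_[p]} {L : PowerSeries ℚ_[p]}
    (hsa : W.HasSplitMultiplicativeReductionAtPrime p → a = 1)
    (hna : ¬ W.HasSplitMultiplicativeReductionAtPrime p → a = -1)
    (hL : IsMultPAdicLFunctionOf f p a L)
    (hcert : ∃ n : ℕ, ‖PowerSeries.coeff n (PowerSeries.C ((ϖ : ℚ) : ℚ_[p]) * L)‖ = 1)
    (κ : ZpExtension ℚ p) (hκ : κ.IsCyclotomic) :
    Set.Finite {s : W.fineSelmerInfty κ | p • s = 0} := by
  obtain ⟨κ₀, hκ₀, γ₀, hγ₀, hγ₀c⟩ := exists_isCyclotomic_isTopGenerator_isCyclotomicVariable_holds p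
  have h0 := finite_fineSelmerInfty_pTorsion_of_muCert_of_multFine hfine h18 hp2 hmult hirr hnsurj hf hϖ hsa hna
    hL hcert κ₀ hκ₀ hγ₀ hγ₀c
  -- transport along `ker κ₀ = ker κ` (the `subst` device of the f3-mu cell's
  -- `finite_fineSelmerInfty_pTorsion_of_isCyclotomic`, inlined to keep this module outside every route cone)
  have hker : κ₀.kerSubgroup = κ.kerSubgroup := ZpExtension.IsCyclotomic.kerSubgroup_eq hκ₀ hκ
  have aux : ∀ {H₀ H : Subgroup (absoluteGaloisGroup ℚ)} [H₀.Normal] [H.Normal], H₀ = H →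
      Set.Finite {s : GreenbergSelmer.strictSelmerGroupOver H₀ (W.geomPrimaryTorsion p) p
        (GreenbergSelmer.fineData (W.geomPrimaryTorsion p) p) | p • s = 0} →
      Set.Finite {s : GreenbergSelmer.strictSelmerGroupOver H (W.geomPrimaryTorsion p) p
        (GreenbergSelmer.fineData (W.geomPrimaryTorsion p) p) | p • s = 0} := by
    intro H₀ H _ _ hH hf
    subst hH
    exact hf
  exact aux hker h0

/-! ### §2 Statement (A) and fine `μ = 0` at the pair -/

/-- **Coates–Sujatha's statement (A) at the pair from ONE μ^an-type certificate, at a multiplicative odd prime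
with `E[p]` irreducible and `ρ̄` not onto** — the multiplicative twin of the f3-mu cell's `conjAAt_of_cert_of_fine`:
`Sel₀[p]` finite over every cyclotomic `κ` (§1) ⟺ the dual is finitely generated over `ℤ_p`
(`IwasawaModuleFinitePadicInt.exists_fineSelmerDualData_moduleFinite_iff_finite_pTorsion`).  CONDITIONAL on the two
displayed facts; closes nothing. [cite: CoatesSujatha2005, §3 (statement (A) and Lemma 3.1)] [cite: LimSujatha2018, §3]
[cite: Kato2004Asterisque, Thm. 12.6 (p. 222) and §17.13 (pp. 279–280)] [cite: Wuthrich2014, Cor. 18 (p. 398)] -/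
theorem conjAAt_of_muCert_of_multFine (hfine : exists_multDivisibilityInputs_fine)
    (h18 : Wuthrich2014.corollary18_padicLFunction_mem_iwasawaAlgebra_multiplicative)
    (hp2 : p ≠ 2) (hmult : W.HasMultiplicativeReductionAtPrime p)
    (hirr : W.HasIrreducibleModPGaloisRep p) (hnsurj : ¬ W.HasSurjectiveModNGaloisRep p)
    {N : ℕ} [NeZero N] {f : CuspForm (Gamma0 N) 2} (hf : IsNewformOf W f)
    {ϖ : ℚ} (hϖ : (ϖ : ℝ) * W.realPeriodRat = plusPeriod f)
    {a : ℚ_[p]} {L : PowerSeries ℚ_[p]}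
    (hsa : W.HasSplitMultiplicativeReductionAtPrime p → a = 1)
    (hna : ¬ W.HasSplitMultiplicativeReductionAtPrime p → a = -1)
    (hL : IsMultPAdicLFunctionOf f p a L)
    (hcert : ∃ n : ℕ, ‖PowerSeries.coeff n (PowerSeries.C ((ϖ : ℚ) : ℚ_[p]) * L)‖ = 1) :
    ConjAAt W p := by
  intro κ hκ
  obtain ⟨γ, hγ⟩ : ∃ γ : absoluteGaloisGroup ℚ, κ.IsTopGenerator γ := κ.surjective (Multiplicative.ofAdd 1)
  exact (exists_fineSelmerDualData_moduleFinite_iff_finite_pTorsion W κ hγ).2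
    (finite_fineSelmerInfty_pTorsion_of_muCert_of_multFine' hfine h18 hp2 hmult hirr hnsurj hf hϖ hsa hna hL
      hcert κ hκ)

/-- **Fine `μ = 0` at the pair** from the same certificate (through (A): `ConjAAt.fineMuZeroAt`).
[cite: CoatesSujatha2005, §3 statement (A), `μ`-form] [cite: Kato2004Asterisque, §13.8 (p. 228) and §17.13 (pp. 279–280)] -/
theorem fineMuZeroAt_of_muCert_of_multFine (hfine : exists_multDivisibilityInputs_fine)
    (h18 : Wuthrich2014.corollary18_padicLFunction_mem_iwasawaAlgebra_multiplicative)
    (hp2 : p ≠ 2) (hmult : W.HasMultiplicativeReductionAtPrime p)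
    (hirr : W.HasIrreducibleModPGaloisRep p) (hnsurj : ¬ W.HasSurjectiveModNGaloisRep p)
    {N : ℕ} [NeZero N] {f : CuspForm (Gamma0 N) 2} (hf : IsNewformOf W f)
    {ϖ : ℚ} (hϖ : (ϖ : ℝ) * W.realPeriodRat = plusPeriod f)
    {a : ℚ_[p]} {L : PowerSeries ℚ_[p]}
    (hsa : W.HasSplitMultiplicativeReductionAtPrime p → a = 1)
    (hna : ¬ W.HasSplitMultiplicativeReductionAtPrime p → a = -1)
    (hL : IsMultPAdicLFunctionOf f p a L)
    (hcert : ∃ n : ℕ, ‖PowerSeries.coeff n (PowerSeries.C ((ϖ : ℚ) : ℚ_[p]) * L)‖ = 1) :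
    FineMuZeroAt W p :=
  (conjAAt_of_muCert_of_multFine hfine h18 hp2 hmult hirr hnsurj hf hϖ hsa hna hL hcert).fineMuZeroAt

/-! ### §3 Supplying `f`, `ϖ`, `L` from print: (A) at the pair from a μ^an statement quantified over all data -/

/-- **(A) at an odd multiplicative pair with `E[p]` irreducible and `ρ̄` not onto, from the μ^an CERTIFICATE SHAPE
of the registered μ-stubs** (`∀` newform `f`, `∀ ϖ` with `ϖ·Ω_W = Ω⁺_f`, `∀` MTT function `L`: some unit
coefficient of `ϖ·L`), modulo FOUR facts: modularity `exists_isNewformOf` supplies `f`; Mazur 1978 Cor. 4.1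
(`mazur_not_dvd_maninConstant_of_odd`, via `exists_unit_mul_plusPeriod_of_irreducible_of_mazur`; `p² ∤ N` because
`p ∥ N`) supplies `ϖ`; the tree's MTT existence theorems supply `L` (split: `exists_isSplitMultPAdicLFunctionOf`;
non-split: `exists_isMultPAdicLFunctionOf_neg_one_of_nonsplit`); then §2.
[cite: Mazur1978, Cor. 4.1] [cite: MazurTateTeitelbaum1986Invent, §I.10 Prop. and §I.14 (14.3)]
[cite: CoatesSujatha2005, §3 statement (A)] [cite: Kato2004Asterisque, §17.13 (pp. 279–280)] -/
theorem conjAAt_of_forall_muCert (hNf : exists_isNewformOf) (hM : mazur_not_dvd_maninConstant_of_odd)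
    (hfine : exists_multDivisibilityInputs_fine)
    (h18 : Wuthrich2014.corollary18_padicLFunction_mem_iwasawaAlgebra_multiplicative)
    (hp2 : p ≠ 2) (hmult : W.HasMultiplicativeReductionAtPrime p)
    (hirr : W.HasIrreducibleModPGaloisRep p) (hnsurj : ¬ W.HasSurjectiveModNGaloisRep p)
    (hAn : ∀ {N : ℕ} [NeZero N] (f : CuspForm (Gamma0 N) 2), IsNewformOf W f →
      ∀ (ϖ : ℚ), (ϖ : ℝ) * W.realPeriodRat = plusPeriod f →
      ∀ (a : ℚ_[p]) (L : PowerSeries ℚ_[p]),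
        (W.HasSplitMultiplicativeReductionAtPrime p → a = 1) →
        (¬ W.HasSplitMultiplicativeReductionAtPrime p → a = -1) →
        IsMultPAdicLFunctionOf f p a L →
        ∃ n : ℕ, ‖PowerSeries.coeff n (PowerSeries.C ((ϖ : ℚ) : ℚ_[p]) * L)‖ = 1) :
    ConjAAt W p := by
  -- a newform (modularity)
  haveI : NeZero (W.conductorNorm ℤ) := ⟨(W.conductorNorm_pos_holds).ne'⟩
  obtain ⟨f, hf⟩ := hNf W
  -- the period ratio (Mazur 1978 Cor. 4.1 at `p ∥ N`: `p² ∤ N`)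
  obtain ⟨u, hu1, hu⟩ := exists_unit_mul_plusPeriod_of_irreducible_of_mazur hM W p hp2 hirr f hf
    (not_sq_dvd_level_of_hasMultiplicativeReductionAtPrime hmult hf)
  have hu0 : u ≠ 0 := by
    rintro rfl
    simp at hu1
  have hϖ : ((u⁻¹ : ℚ) : ℝ) * W.realPeriodRat = plusPeriod f := by
    rw [hu, ← mul_assoc, Rat.cast_inv, inv_mul_cancel₀ (by exact_mod_cast hu0), one_mul]
  -- the Mazur–Tate–Teitelbaum function, by the split type, and §2
  by_cases hsplit : W.HasSplitMultiplicativeReductionAtPrime p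
  · obtain ⟨L, hL⟩ := exists_isSplitMultPAdicLFunctionOf hsplit hf
    have hL1 : IsMultPAdicLFunctionOf f p 1 L := (isMultPAdicLFunctionOf_one_iff L).mpr hL
    exact conjAAt_of_muCert_of_multFine hfine h18 hp2 hmult hirr hnsurj hf hϖ (fun _ ↦ rfl)
      (fun h ↦ absurd hsplit h) hL1
      (hAn f hf u⁻¹ hϖ 1 L (fun _ ↦ rfl) (fun h ↦ absurd hsplit h) hL1)
  · obtain ⟨L, hL⟩ := exists_isMultPAdicLFunctionOf_neg_one_of_nonsplit hf hmult hsplit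
    exact conjAAt_of_muCert_of_multFine hfine h18 hp2 hmult hirr hnsurj hf hϖ (fun h ↦ absurd h hsplit)
      (fun _ ↦ rfl) hL
      (hAn f hf u⁻¹ hϖ (-1) L (fun h ↦ absurd h hsplit) (fun _ ↦ rfl) hL)

end PerPair

/-! ### §4 The line edge on the U3 domain: `stub_muAnHardThree` + four facts ⟹ `stub_conjA_hardThree` -/

/-- **LINE «finemu3», μ-road ⟹ (A)-road on the HARD sub-locus**: the registered stub `stub_muAnHardThree`
(`Theorems.X11aNonSurjMuAnHardThree`: analytic `μ = 0` certificate at the non-surjective X11a pairs with `p = 3`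
that are split at `3` or have `ord_3(L(E,1)/Ω_E) ≠ 0`) and four conjuncts of K2's bundle 19949 give the statement of
the registered stub `stub_conjA_hardThree` VERBATIM (lead reshape r1 of `Cruxes/UpperNonSurjThree/Lines/finemu3.lean`).
CONDITIONAL; closes nothing (both stubs stay open). [cite: CoatesSujatha2005, §3 statement (A)]
[cite: GreenbergLNM1716, §1 Conj. 1.11 (the certificate's shape)] [cite: Kato2004Asterisque, §17.13 (pp. 279–280)] -/
theorem conjAHardThree_of_muAnHardThree (hNf : exists_isNewformOf) (hM : mazur_not_dvd_maninConstant_of_odd)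
    (hfine : exists_multDivisibilityInputs_fine)
    (h18 : Wuthrich2014.corollary18_padicLFunction_mem_iwasawaAlgebra_multiplicative)
    (hμ : Theorems.X11aNonSurjMuAnHardThree) :
    ∀ (W : WeierstrassCurve ℚ) [W.IsElliptic] [W.IsGloballyMinimal] (p : ℕ) [Fact p.Prime],
      ClassX11a W p → ¬ Surj W p → p = 3 →
      (W.HasSplitMultiplicativeReductionAtPrime p ∨
        ∀ t : ℚ, W.entireLFunction 1 / (W.realPeriodRat : ℂ) = (t : ℂ) → padicValRat p t ≠ 0) →
      ConjAAt W p :=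
  fun W _ _ p _ hX hns hp3 hhard ↦
    conjAAt_of_forall_muCert hNf hM hfine h18 hX.2.1 hX.2.2.1 hX.2.2.2.1 hns
      (fun f hf ϖ hϖ a L hsa hna hL ↦ hμ W p hX hns hp3 hhard f hf ϖ hϖ a L hsa hna hL)

/-- **The same on the WHOLE U3 domain**: a whole-domain analytic certificate (the shape of the superseded birth
stub `stub_muAnAtThree` = `Theorems.X11aNonSurjMuAnAtThree` with the locus hypothesis dropped, stated here as an
explicit binder to avoid importing it) gives the statement of the registered stub `stub_conjA_three` VERBATIM.
CONDITIONAL; closes nothing. [cite: CoatesSujatha2005, §3 statement (A)] [cite: GreenbergLNM1716, §1 Conj. 1.11 (shape)] -/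
theorem conjAThree_of_muAn_onDomain (hNf : exists_isNewformOf) (hM : mazur_not_dvd_maninConstant_of_odd)
    (hfine : exists_multDivisibilityInputs_fine)
    (h18 : Wuthrich2014.corollary18_padicLFunction_mem_iwasawaAlgebra_multiplicative)
    (hμ : ∀ (W : WeierstrassCurve ℚ) [W.IsElliptic] [W.IsGloballyMinimal] (p : ℕ) [Fact p.Prime],
      ClassX11a W p → ¬ Surj W p → p = 3 →
      ∀ {N : ℕ} [NeZero N] (f : CuspForm (Gamma0 N) 2), IsNewformOf W f →
        ∀ (ϖ : ℚ), (ϖ : ℝ) * W.realPeriodRat = plusPeriod f →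
        ∀ (a : ℚ_[p]) (L : PowerSeries ℚ_[p]),
          (W.HasSplitMultiplicativeReductionAtPrime p → a = 1) →
          (¬ W.HasSplitMultiplicativeReductionAtPrime p → a = -1) →
          IsMultPAdicLFunctionOf f p a L →
          ∃ n : ℕ, ‖PowerSeries.coeff n (PowerSeries.C ((ϖ : ℚ) : ℚ_[p]) * L)‖ = 1) :
    ∀ (W : WeierstrassCurve ℚ) [W.IsElliptic] [W.IsGloballyMinimal] (p : ℕ) [Fact p.Prime],
      ClassX11a W p → ¬ Surj W p → p = 3 → ConjAAt W p :=
  fun W _ _ p _ hX hns hp3 ↦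
    conjAAt_of_forall_muCert hNf hM hfine h18 hX.2.1 hX.2.2.1 hX.2.2.2.1 hns
      (fun f hf ϖ hϖ a L hsa hna hL ↦ hμ W p hX hns hp3 f hf ϖ hϖ a L hsa hna hL)

end Summit.BirchSwinnertonDyer.BirchSwinnertonDyer.Theorems.UpperNonSurjThreeConjAOfMuAn

end
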